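import Summits.Ventures.PercRepro.ThetaSigmaProj

/-!
# (Σ): the star lemma — credit-free co-pair points share a co-pair member

Dossier proofs/MINE1-theoremS.md, Addendum 78 (mine-1, gen 40). A **co-pair** at a point `p`
of a (Σ)-instance `X` on `U` is a pair of members partitioning `U ∖ p` (`IsCopairAt`); the
credit at `p` is **trivial** when the only `p`-edge of the family is `(∅, {p})`
(`CreditTrivialAt`: every member of `creditS U p X` is `∅`). Addendum 76 classifies (census) the
points at which the Credit Lemma fails as exactly the points with one co-pair, one co-co-pair and
trivial credit. This file proves, with no census and no classification:

* `copair_inter_of_creditTrivial` — **the two-point star lemma**: if `p ≠ q` both carry a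
  co-pair and a trivial credit, then the two co-pairs share a member `m` with `p, q ∉ m` (the
  co-join of one member of each co-pair is a partner meet plus the point, a `p`- or `q`-edge
  that the trivial credit forbids);
* the global form — the star on ≥ 4 points, `∅ ∈ X` — is `ThetaSigmaStarGlobal.lean`.
-/

namespace PercRepro.MSTight

open Finset

variable {α : Type*} [DecidableEq α]

section StarDefs

variable {U : Finset α} {X : Finset (Finset α)} {p q : α}

/-- A **co-pair at `p`**: two members of `X` partitioning `U ∖ p`. -/
def IsCopairAt (U : Finset α) (p : α) (X : Finset (Finset α)) (x y : Finset α) : Prop :=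
  x ∈ X ∧ y ∈ X ∧ x ⊓ y = ∅ ∧ x ⊔ y = U.erase p

/-- **Trivial credit at `p`**: every `p`-edge of the family is `(∅, {p})`. -/
def CreditTrivialAt (U : Finset α) (p : α) (X : Finset (Finset α)) : Prop :=
  ∀ d ∈ creditS U p X, d = ∅

/-- A co-pair is symmetric. -/
theorem IsCopairAt.symm {x y : Finset α} (h : IsCopairAt U p X x y) : IsCopairAt U p X y x :=
  ⟨h.2.1, h.1, by rw [inf_comm]; exact h.2.2.1, by rw [sup_comm]; exact h.2.2.2⟩

/-- The members of a co-pair at `p` avoid `p`. -/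
theorem IsCopairAt.notMem_left {x y : Finset α} (h : IsCopairAt U p X x y) : p ∉ x := by
  intro hp
  have : p ∈ x ⊔ y := mem_union_left y hp
  rw [h.2.2.2] at this
  exact (mem_erase.1 this).1 rfl

/-- The members of a co-pair at `p` avoid `p`. -/
theorem IsCopairAt.notMem_right {x y : Finset α} (h : IsCopairAt U p X x y) : p ∉ y :=
  h.symm.notMem_left

/-- Pointwise form of a co-pair: `a ∈ U ∖ p ↔ a ∈ x ∨ a ∈ y`, and never both. -/
theorem IsCopairAt.mem_iff {x y : Finset α} (h : IsCopairAt U p X x y) (a : α) :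
    ((a ≠ p ∧ a ∈ U) ↔ (a ∈ x ∨ a ∈ y)) ∧ ¬ (a ∈ x ∧ a ∈ y) := by
  have h1 := Finset.ext_iff.1 h.2.2.2 a
  have h2 := Finset.ext_iff.1 h.2.2.1 a
  simp only [sup_eq_union, mem_union, mem_erase, inf_eq_inter, mem_inter, notMem_empty,
    iff_false] at h1 h2
  exact ⟨h1.symm, h2⟩

/-- A `p`-edge of the family is forbidden by a trivial credit unless its `p`-free end is `∅`. -/
theorem eq_empty_of_creditTrivial (hc : CreditTrivialAt U p X) {d : Finset α}
    (hd : d ∈ sigmaD U X) (hpd : p ∉ d) (hd' : insert p d ∈ sigmaD U X) : d = ∅ :=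
  hc d (mem_creditS.2 ⟨hd, hpd, hd'⟩)

end StarDefs

section TwoPoint

variable {U : Finset α} {X : Finset (Finset α)} {p q : α}

/-- The two-point star lemma in the normalised position `p ∈ xq`. -/
theorem copair_inter_of_creditTrivial_aux (hp : p ∈ U) (hq : q ∈ U) (hpq : p ≠ q)
    {xp yp xq yq : Finset α} (hcp : IsCopairAt U p X xp yp) (hcq : IsCopairAt U q X xq yq)
    (hp' : p ∈ xq) (htp : CreditTrivialAt U p X) (htq : CreditTrivialAt U q X) :
    ∃ m ∈ X, p ∉ m ∧ q ∉ m ∧ (m = xp ∨ m = yp) ∧ (m = xq ∨ m = yq) := by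
  have hpxp := hcp.notMem_left
  have hpyp := hcp.notMem_right
  have hqxq := hcq.notMem_left
  have hqyq := hcq.notMem_right
  have hpyq : p ∉ yq := fun h => (hcq.mem_iff p).2 ⟨hp', h⟩
  -- `q ∈ U ∖ p = xp ⊔ yp`
  have hq' : q ∈ xp ∨ q ∈ yp := ((hcp.mem_iff q).1).1 ⟨Ne.symm hpq, hq⟩
  rcases hq' with hqxp | hqyp
  · -- Case `q ∈ xp`: the shared member is `yp = yq`
    have hqyp : q ∉ yp := fun h => (hcp.mem_iff q).2 ⟨hqxp, h⟩
    -- the co-join of `xp, yq` is `(yp ⊓ xq) + p`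
    have hcoj1 : U \ (xp ⊔ yq) = insert p (yp ⊓ xq) := by
      ext a
      have e1 := hcp.mem_iff a
      have e2 := hcq.mem_iff a
      simp only [mem_sdiff, sup_eq_union, mem_union, mem_insert, inf_eq_inter, mem_inter]
      by_cases hap : a = p
      · subst hap
        simp only [true_or, iff_true]
        exact ⟨hp, fun h => h.elim hpxp hpyq⟩
      · simp only [hap, false_or]
        constructor
        · rintro ⟨haU, hn⟩
          have haxp : a ∉ xp := fun h => hn (Or.inl h)
          have hayq : a ∉ yq := fun h => hn (Or.inr h)
          have haq : a ≠ q := fun h => haxp (h ▸ hqxp)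
          refine ⟨?_, ?_⟩
          · rcases (e1.1).1 ⟨hap, haU⟩ with h | h
            · exact absurd h haxp
            · exact h
          · rcases (e2.1).1 ⟨haq, haU⟩ with h | h
            · exact h
            · exact absurd h hayq
        · rintro ⟨hayp, haxq⟩
          refine ⟨((e1.1).2 (Or.inr hayp)).2, ?_⟩
          rintro (h | h)
          · exact e1.2 ⟨h, hayp⟩
          · exact e2.2 ⟨haxq, h⟩
    -- the co-join of `yp, xq` is `(xp ⊓ yq) + q`
    have hcoj2 : U \ (yp ⊔ xq) = insert q (xp ⊓ yq) := by
      ext a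
      have e1 := hcp.mem_iff a
      have e2 := hcq.mem_iff a
      simp only [mem_sdiff, sup_eq_union, mem_union, mem_insert, inf_eq_inter, mem_inter]
      by_cases haq : a = q
      · subst haq
        simp only [true_or, iff_true]
        exact ⟨hq, fun h => h.elim hqyp hqxq⟩
      · simp only [haq, false_or]
        constructor
        · rintro ⟨haU, hn⟩
          have hayp : a ∉ yp := fun h => hn (Or.inl h)
          have haxq : a ∉ xq := fun h => hn (Or.inr h)
          have hap : a ≠ p := fun h => haxq (h ▸ hp')
          refine ⟨?_, ?_⟩
          · rcases (e1.1).1 ⟨hap, haU⟩ with h | h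
            · exact h
            · exact absurd h hayp
          · rcases (e2.1).1 ⟨haq, haU⟩ with h | h
            · exact absurd h haxq
            · exact h
        · rintro ⟨haxp, hayq⟩
          refine ⟨((e1.1).2 (Or.inl haxp)).2, ?_⟩
          rintro (h | h)
          · exact e1.2 ⟨haxp, h⟩
          · exact e2.2 ⟨h, hayq⟩
    have hne1 : xp ≠ yq := fun h => hqyq (h ▸ hqxp)
    have hne2 : yp ≠ xq := fun h => hpyp (h.symm ▸ hp')
    -- the `p`-edge `(yp ⊓ xq, (yp ⊓ xq) + p)` forces `yp ⊓ xq = ∅`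
    have h1 : yp ⊓ xq = ∅ := by
      refine eq_empty_of_creditTrivial htp (inf_mem_sigmaD hne2 hcp.2.1 hcq.1) ?_ ?_
      · simp only [inf_eq_inter, mem_inter, not_and]
        exact fun h => absurd h hpyp
      · rw [← hcoj1]
        exact sdiff_sup_mem_sigmaD hne1 hcp.1 hcq.2.1
    -- the `q`-edge `(xp ⊓ yq, (xp ⊓ yq) + q)` forces `xp ⊓ yq = ∅`
    have h2 : xp ⊓ yq = ∅ := by
      refine eq_empty_of_creditTrivial htq (inf_mem_sigmaD hne1 hcp.1 hcq.2.1) ?_ ?_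
      · simp only [inf_eq_inter, mem_inter, not_and]
        exact fun _ => hqyq
      · rw [← hcoj2]
        exact sdiff_sup_mem_sigmaD hne2 hcp.2.1 hcq.1
    -- hence `yp = yq`
    have hyy : yp = yq := by
      ext a
      have e1 := hcp.mem_iff a
      have e2 := hcq.mem_iff a
      have d1 := Finset.ext_iff.1 h1 a
      have d2 := Finset.ext_iff.1 h2 a
      simp only [inf_eq_inter, mem_inter, notMem_empty, iff_false] at d1 d2
      constructor
      · intro hayp
        have haU := ((e1.1).2 (Or.inr hayp)).2
        have haq : a ≠ q := fun h => hqyp (h ▸ hayp)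
        rcases (e2.1).1 ⟨haq, haU⟩ with h | h
        · exact absurd ⟨hayp, h⟩ d1
        · exact h
      · intro hayq
        have haU := ((e2.1).2 (Or.inr hayq)).2
        have hap : a ≠ p := fun h => hpyq (h ▸ hayq)
        rcases (e1.1).1 ⟨hap, haU⟩ with h | h
        · exact absurd ⟨h, hayq⟩ d2
        · exact h
    exact ⟨yp, hcp.2.1, hpyp, hqyp, Or.inr rfl, Or.inr hyy⟩
  · -- Case `q ∈ yp`: the shared member is `xp = yq`
    have hqxp : q ∉ xp := fun h => (hcp.mem_iff q).2 ⟨h, hqyp⟩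
    -- the co-join of `xp, xq` is `(yp ⊓ yq) + q`
    have hcoj1 : U \ (xp ⊔ xq) = insert q (yp ⊓ yq) := by
      ext a
      have e1 := hcp.mem_iff a
      have e2 := hcq.mem_iff a
      simp only [mem_sdiff, sup_eq_union, mem_union, mem_insert, inf_eq_inter, mem_inter]
      by_cases haq : a = q
      · subst haq
        simp only [true_or, iff_true]
        exact ⟨hq, fun h => h.elim hqxp hqxq⟩
      · simp only [haq, false_or]
        constructor
        · rintro ⟨haU, hn⟩
          have haxp : a ∉ xp := fun h => hn (Or.inl h)
          have haxq : a ∉ xq := fun h => hn (Or.inr h)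
          have hap : a ≠ p := fun h => haxq (h ▸ hp')
          refine ⟨?_, ?_⟩
          · rcases (e1.1).1 ⟨hap, haU⟩ with h | h
            · exact absurd h haxp
            · exact h
          · rcases (e2.1).1 ⟨haq, haU⟩ with h | h
            · exact absurd h haxq
            · exact h
        · rintro ⟨hayp, hayq⟩
          refine ⟨((e1.1).2 (Or.inr hayp)).2, ?_⟩
          rintro (h | h)
          · exact e1.2 ⟨h, hayp⟩
          · exact e2.2 ⟨h, hayq⟩
    -- the co-join of `yp, yq` is `(xp ⊓ xq) + p`
    have hcoj2 : U \ (yp ⊔ yq) = insert p (xp ⊓ xq) := by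
      ext a
      have e1 := hcp.mem_iff a
      have e2 := hcq.mem_iff a
      simp only [mem_sdiff, sup_eq_union, mem_union, mem_insert, inf_eq_inter, mem_inter]
      by_cases hap : a = p
      · subst hap
        simp only [true_or, iff_true]
        exact ⟨hp, fun h => h.elim hpyp hpyq⟩
      · simp only [hap, false_or]
        constructor
        · rintro ⟨haU, hn⟩
          have hayp : a ∉ yp := fun h => hn (Or.inl h)
          have hayq : a ∉ yq := fun h => hn (Or.inr h)
          have haq : a ≠ q := fun h => hayp (h ▸ hqyp)
          refine ⟨?_, ?_⟩
          · rcases (e1.1).1 ⟨hap, haU⟩ with h | h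
            · exact h
            · exact absurd h hayp
          · rcases (e2.1).1 ⟨haq, haU⟩ with h | h
            · exact h
            · exact absurd h hayq
        · rintro ⟨haxp, haxq⟩
          refine ⟨((e1.1).2 (Or.inl haxp)).2, ?_⟩
          rintro (h | h)
          · exact e1.2 ⟨haxp, h⟩
          · exact e2.2 ⟨haxq, h⟩
    have hne1 : xp ≠ xq := fun h => hpxp (h.symm ▸ hp')
    have hne2 : yp ≠ yq := fun h => hqyq (h ▸ hqyp)
    -- the `q`-edge `(yp ⊓ yq, (yp ⊓ yq) + q)` forces `yp ⊓ yq = ∅`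
    have h1 : yp ⊓ yq = ∅ := by
      refine eq_empty_of_creditTrivial htq (inf_mem_sigmaD hne2 hcp.2.1 hcq.2.1) ?_ ?_
      · simp only [inf_eq_inter, mem_inter, not_and]
        exact fun _ => hqyq
      · rw [← hcoj1]
        exact sdiff_sup_mem_sigmaD hne1 hcp.1 hcq.1
    -- the `p`-edge `(xp ⊓ xq, (xp ⊓ xq) + p)` forces `xp ⊓ xq = ∅`
    have h2 : xp ⊓ xq = ∅ := by
      refine eq_empty_of_creditTrivial htp (inf_mem_sigmaD hne1 hcp.1 hcq.1) ?_ ?_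
      · simp only [inf_eq_inter, mem_inter, not_and]
        exact fun h => absurd h hpxp
      · rw [← hcoj2]
        exact sdiff_sup_mem_sigmaD hne2 hcp.2.1 hcq.2.1
    -- hence `xp = yq`
    have hxy : xp = yq := by
      ext a
      have e1 := hcp.mem_iff a
      have e2 := hcq.mem_iff a
      have d1 := Finset.ext_iff.1 h1 a
      have d2 := Finset.ext_iff.1 h2 a
      simp only [inf_eq_inter, mem_inter, notMem_empty, iff_false] at d1 d2
      constructor
      · intro haxp
        have haU := ((e1.1).2 (Or.inl haxp)).2
        have haq : a ≠ q := fun h => hqxp (h ▸ haxp)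
        rcases (e2.1).1 ⟨haq, haU⟩ with h | h
        · exact absurd ⟨haxp, h⟩ d2
        · exact h
      · intro hayq
        have haU := ((e2.1).2 (Or.inr hayq)).2
        have hap : a ≠ p := fun h => hpyq (h ▸ hayq)
        rcases (e1.1).1 ⟨hap, haU⟩ with h | h
        · exact h
        · exact absurd ⟨h, hayq⟩ d1
    exact ⟨xp, hcp.1, hpxp, hqxp, Or.inl rfl, Or.inr hxy⟩

/-- **The two-point star lemma**: two distinct points carrying co-pairs with trivial credits share
a co-pair member that avoids both points. -/
theorem copair_inter_of_creditTrivial (hp : p ∈ U) (hq : q ∈ U) (hpq : p ≠ q)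
    {xp yp xq yq : Finset α} (hcp : IsCopairAt U p X xp yp) (hcq : IsCopairAt U q X xq yq)
    (htp : CreditTrivialAt U p X) (htq : CreditTrivialAt U q X) :
    ∃ m ∈ X, p ∉ m ∧ q ∉ m ∧ (m = xp ∨ m = yp) ∧ (m = xq ∨ m = yq) := by
  rcases ((hcq.mem_iff p).1).1 ⟨hpq, hp⟩ with hp' | hp'
  · exact copair_inter_of_creditTrivial_aux hp hq hpq hcp hcq hp' htp htq
  · obtain ⟨m, hm, hpm, hqm, h1, h2⟩ :=
      copair_inter_of_creditTrivial_aux hp hq hpq hcp hcq.symm hp' htp htq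
    exact ⟨m, hm, hpm, hqm, h1, h2.symm⟩

end TwoPoint

end PercRepro.MSTight
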